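import Summits.Ventures.LatticeQCDFlow.Scoring.U1CharacterExpansion
import HarnessLib

/-!
# Abelian duality for general plaquette weights (absolutely summable Fourier series)

HONEST FRAMING: exact (Metropolis-corrected) sampling algorithms for lattice gauge theory;
figures of merit are autocorrelation/cost numbers at stated couplings and volumes; no
continuum-physics claim.

Venture `LatticeQCDFlow` (cell pub-lqcd), sub-topic `Scoring`; FANOUT row 5 (`s0-sun-a`), GEN-7.
NEW WORK of the cell (placement rule).  `Scoring/U1CharacterExpansion.lean` proves the duality
formula for the Wilson weight `∏_p e^{β_p cos θ_p}`; the argument only uses that each plaquette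
factor is an absolutely summable Fourier series in the plaquette angle.  This file records the
general statement, for arbitrary per-plaquette weights

  `w_p(φ) = Σ_{k ∈ ℤ} a_p(k) e^{ikφ}`,  `Σ_k ‖a_p(k)‖ < ∞`  (complex coefficients),

on the same finite complex (`n + 1` link angles on `(0, 2π]^{n+1}`, integer incidences `inc p l`):

* **`setIntegral_cexp_mul_prod_weight`** — for every integer link charge `c`,
  `∫_{(0,2π]^{n+1}} e^{i Σ_l c_l θ_l} ∏_p w_p(θ_p) dθ
     = (2π)^{n+1} Σ_{m : ι → ℤ} [∀ l, c_l + Σ_p m_p inc p l = 0] ∏_p a_p(m_p)`.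

Instances: the Wilson weight (`a_p(k) = I_{|k|}(β_p)`, the companion file), heat-kernel / Villain
weights (`a(k) = e^{−k²/(2β)}`), and the topological-charge characteristic function
`w(φ) = e^{β cos φ} e^{iαφ̂}` (`φ̂` the principal value), whose duality sum gives the exact law of
the 2-d topological charge — the route to the sector-weight / `χ_t` references of the cell's
`ORACLE-u1-2d.json` (NOT carried out here).

NOT here: any specific weight beyond the statement; convergence in `α`; non-abelian groups.
-/

noncomputable section

open Real MeasureTheory Set Finset Literature.Analysis.FunctionSpaces

namespace Summit.Ventures.LatticeQCDFlow.Scoring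

section General

variable {n : ℕ} {ι : Type*} [Fintype ι] (inc : ι → Fin (n + 1) → ℤ)
  (w : ι → ℝ → ℂ) (a : ι → ℤ → ℂ)

/-- The product of the plaquette weights as an absolutely convergent character sum:
`∏_p w_p(θ_p) = Σ_{m : ι → ℤ} ∏_p a_p(m_p) e^{i m_p θ_p}`, with the family summable in norm. -/
theorem prod_weight_eq_tsum (hw : ∀ p (u : ℝ), HasSum (fun k : ℤ => a p k * Complex.exp ((k : ℂ) * u * Complex.I)) (w p u))
    (ha : ∀ p, Summable fun k => ‖a p k‖) (θ : Fin (n + 1) → ℝ) :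
    (Summable fun m : ι → ℤ => ‖∏ p, a p (m p) *
        Complex.exp (((m p : ℤ) : ℂ) * u1PlaqAngle inc p θ * Complex.I)‖) ∧
      ∏ p, w p (u1PlaqAngle inc p θ) = ∑' m : ι → ℤ, ∏ p, a p (m p) *
        Complex.exp (((m p : ℤ) : ℂ) * u1PlaqAngle inc p θ * Complex.I) := by
  have hF : ∀ p, Summable fun k : ℤ => ‖a p k * Complex.exp ((k : ℂ) * u1PlaqAngle inc p θ * Complex.I)‖ :=
    fun p => (ha p).congr fun k => by
      rw [norm_mul, show (k : ℂ) * u1PlaqAngle inc p θ * Complex.I =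
        (((k : ℝ) * u1PlaqAngle inc p θ : ℝ) : ℂ) * Complex.I by push_cast; ring,
        Complex.norm_exp_ofReal_mul_I, mul_one]
  obtain ⟨hS, hT⟩ := summable_norm_prod_and_tsum_prod_eq_fintype
    (fun p k => a p k * Complex.exp ((k : ℂ) * u1PlaqAngle inc p θ * Complex.I)) hF
  refine ⟨hS, ?_⟩
  rw [hT]
  exact Finset.prod_congr rfl fun p _ => ((hw p (u1PlaqAngle inc p θ)).tsum_eq).symm

/-- Collecting the phases link by link:
`∏_p a_p(m_p) e^{i m_p θ_p} = (∏_p a_p(m_p)) · e^{i Σ_l (Σ_p m_p inc p l) θ_l}`. -/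
theorem prod_weightTerm_eq (m : ι → ℤ) (θ : Fin (n + 1) → ℝ) :
    ∏ p, a p (m p) * Complex.exp (((m p : ℤ) : ℂ) * u1PlaqAngle inc p θ * Complex.I) =
      (∏ p, a p (m p)) * Complex.exp ((∑ l, ((∑ p, m p * inc p l : ℤ) : ℂ) * θ l) * Complex.I) := by
  rw [Finset.prod_mul_distrib, ← Complex.exp_sum, ← Finset.sum_mul]
  congr 3
  simp only [u1PlaqAngle, Complex.ofReal_sum, Complex.ofReal_mul, Complex.ofReal_intCast,
    Finset.mul_sum, Int.cast_sum, Int.cast_mul, Finset.sum_mul]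
  rw [Finset.sum_comm]
  exact Finset.sum_congr rfl fun l _ => Finset.sum_congr rfl fun p _ => by ring

/-- `m ↦ ‖∏_p a_p(m_p)‖` is summable. -/
theorem summable_norm_prod_coeff (ha : ∀ p, Summable fun k => ‖a p k‖) :
    Summable fun m : ι → ℤ => ‖∏ p, a p (m p)‖ :=
  (summable_norm_prod_and_tsum_prod_eq_fintype a ha).1

/-- **Abelian duality for general absolutely summable plaquette weights.**  If
`w_p(φ) = Σ_k a_p(k) e^{ikφ}` with `Σ_k ‖a_p(k)‖ < ∞` for every plaquette `p`, then for every integer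
link charge `c`,
`∫_{(0,2π]^{n+1}} e^{i Σ_l c_l θ_l} ∏_p w_p(θ_p) dθ
   = (2π)^{n+1} Σ_{m : ι → ℤ} [∀ l, c_l + Σ_p m_p inc p l = 0] ∏_p a_p(m_p)`. -/
theorem setIntegral_cexp_mul_prod_weight [DecidableEq ι]
    (hw : ∀ p (u : ℝ), HasSum (fun k : ℤ => a p k * Complex.exp ((k : ℂ) * u * Complex.I)) (w p u))
    (ha : ∀ p, Summable fun k => ‖a p k‖) (c : Fin (n + 1) → ℤ) :
    ∫ θ in u1TorusBox (n + 1), Complex.exp ((∑ l, (c l : ℂ) * θ l) * Complex.I) *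
        ∏ p, w p (u1PlaqAngle inc p θ) =
      (2 * π : ℂ) ^ (n + 1) * ∑' m : ι → ℤ,
        if (∀ l, c l + ∑ p, m p * inc p l = 0) then ∏ p, a p (m p) else 0 := by
  set G : (ι → ℤ) → (Fin (n + 1) → ℝ) → ℂ := fun m θ =>
    (∏ p, a p (m p)) *
      Complex.exp ((∑ l, ((c l + ∑ p, m p * inc p l : ℤ) : ℂ) * θ l) * Complex.I) with hG
  have hpt : ∀ θ : Fin (n + 1) → ℝ,
      Complex.exp ((∑ l, (c l : ℂ) * θ l) * Complex.I) * ∏ p, w p (u1PlaqAngle inc p θ) =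
        ∑' m : ι → ℤ, G m θ := by
    intro θ
    rw [(prod_weight_eq_tsum inc w a hw ha θ).2, ← tsum_mul_left]
    refine tsum_congr fun m => ?_
    rw [prod_weightTerm_eq, hG, mul_left_comm, ← Complex.exp_add, ← add_mul,
      ← Finset.sum_add_distrib]
    congr 3
    refine Finset.sum_congr rfl fun l _ => ?_
    push_cast
    ring
  have hGcont : ∀ m, Continuous (G m) := fun m => by
    simp only [hG]
    fun_prop
  have hGint : ∀ m, Integrable (G m) ((volume : Measure (Fin (n + 1) → ℝ)).restrict
      (u1TorusBox (n + 1))) := fun m => integrableOn_u1TorusBox' (hGcont m)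
  have hGnorm : ∀ m θ, ‖G m θ‖ = ‖∏ p, a p (m p)‖ := by
    intro m θ
    rw [hG, norm_mul, show (∑ l, ((c l + ∑ p, m p * inc p l : ℤ) : ℂ) * θ l) * Complex.I =
      ((∑ l, ((c l + ∑ p, m p * inc p l : ℤ) : ℝ) * θ l : ℝ) : ℂ) * Complex.I by push_cast; ring,
      Complex.norm_exp_ofReal_mul_I, mul_one]
  have hGsum : Summable fun m => ∫ θ in u1TorusBox (n + 1), ‖G m θ‖ := by
    simp_rw [hGnorm, setIntegral_const]
    exact (summable_norm_prod_coeff a ha).const_smul _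
  have hfun : (fun θ : Fin (n + 1) → ℝ =>
      Complex.exp ((∑ l, (c l : ℂ) * θ l) * Complex.I) * ∏ p, w p (u1PlaqAngle inc p θ)) =
        fun θ => ∑' m : ι → ℤ, G m θ := funext hpt
  rw [hfun, ← integral_tsum_of_summable_integral_norm hGint hGsum, ← tsum_mul_left]
  refine tsum_congr fun m => ?_
  have h3 := integral_u1TorusBox_cexp_sum fun l => c l + ∑ p, m p * inc p l
  rw [hG]
  simp only at h3 ⊢
  rw [MeasureTheory.integral_const_mul, h3]
  split_ifs <;> ring

/-- The special case `c = 0`: `∫ ∏_p w_p(θ_p) dθ = (2π)^{n+1} Σ_m [∀ l, Σ_p m_p inc p l = 0] ∏_p a_p(m_p)`. -/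
theorem setIntegral_prod_weight [DecidableEq ι]
    (hw : ∀ p (u : ℝ), HasSum (fun k : ℤ => a p k * Complex.exp ((k : ℂ) * u * Complex.I)) (w p u))
    (ha : ∀ p, Summable fun k => ‖a p k‖) :
    ∫ θ in u1TorusBox (n + 1), ∏ p, w p (u1PlaqAngle inc p θ) =
      (2 * π : ℂ) ^ (n + 1) * ∑' m : ι → ℤ,
        if (∀ l, ∑ p, m p * inc p l = 0) then ∏ p, a p (m p) else 0 := by
  have h := setIntegral_cexp_mul_prod_weight inc w a hw ha 0
  simp only [Pi.zero_apply, Int.cast_zero, zero_mul, Finset.sum_const_zero, Complex.exp_zero,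
    one_mul, zero_add] at h
  exact h

/-- Consistency with the Wilson case: the general formula with `a_p(k) = I_{|k|}(β_p)` is the
character expansion of `Scoring/U1CharacterExpansion.lean`. -/
theorem setIntegral_cexp_mul_u1WilsonWeight' [DecidableEq ι] (βp : ι → ℝ) (c : Fin (n + 1) → ℤ) :
    ∫ θ in u1TorusBox (n + 1), Complex.exp ((∑ l, (c l : ℂ) * θ l) * Complex.I) *
        ∏ p, Complex.exp ((βp p : ℂ) * Real.cos (u1PlaqAngle inc p θ)) =
      (2 * π : ℂ) ^ (n + 1) * ∑' m : ι → ℤ,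
        if (∀ l, c l + ∑ p, m p * inc p l = 0) then ∏ p, (besselI (m p).natAbs (βp p) : ℂ) else 0 :=
  setIntegral_cexp_mul_prod_weight inc (fun p u => Complex.exp ((βp p : ℂ) * Real.cos u))
    (fun p k => (besselI k.natAbs (βp p) : ℂ)) (fun p u => hasSum_besselI_natAbs_mul_cexp (βp p) u)
    (fun p => by
      simpa [Complex.norm_real, Real.norm_eq_abs, abs_besselI_eq_besselI_abs] using
        summable_besselI_natAbs |βp p|) c

end General

end Summit.Ventures.LatticeQCDFlow.Scoring
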